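import Summits.HodgeConjecture.CorCM.MumfordTateRankSixClassification
import Summits.HodgeConjecture.CorCM.MumfordTateRankSixHodge
import Summits.HodgeConjecture.CorCM.CMAbelianFourfoldPowers
import Summits.HodgeConjecture.CorCM.AndreRiemannBiproducts
import Literature.AlgebraicGeometry.Motives.HodgeLieOfAbelianVarietyBiproduct
import HarnessLib

/-!
# The rungs `dim MT(H¹(X)) ≤ 6`, IX: the converse — `B^{m+1} × S^{N+1}` and `B^{m+1} × E₀^{a} × E₁^{b}` have
# Mumford–Tate rank exactly `6`; the rung `dim MT = 6` (non-CM) as an iff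

COR-CM (cell `pub-hodgecm2`, seat `b27` gen 38, count-neutral lane MT-RANK-SIX-CMPART; theorems only, no definition,
no named fact; UNCONDITIONAL — nothing here uses or asserts HC_CM).  Converse of `CorCM/MumfordTateRankSixClassification`.

`B` is a SIMPLE complex abelian variety NOT of CM type with `0 < dim B ≤ 2` and `dim_ℚ End⁰(B) = (dim B)²` (non-CM elliptic
curve or QM surface; `dim Lie Hg(H¹B) ≤ 3`, `not_le_endAlg_and_finrank_hodgeLie_le_three_of_factor`).

* `finrank_hodgeLie_hodge_one_le_add_of_isIsogenous_powSucc_prod` — `X ∼ B^{m+1} × Z` ⟹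
  `dim Lie Hg(H¹X) ≤ dim Lie Hg(H¹B) + dim Lie Hg(H¹Z)` (any `B`, `Z`: `Hg(Y × Z) ⊆ Hg(Y) × Hg(Z)`, `Hg(B^{m+1}) = Hg(B)`,
  Lie form, `Motives/HodgeLieOfAbelianVarietyBiproduct`).
* `not_isOfCMType_and_mtRank_le_six_of_isIsogenous_powSucc_prod` — `X ∼ B^{m+1} × Z` with `dim Lie Hg(H¹Z) ≤ 2` ⟹ `X`
  is not of CM type and `dim MT(H¹X) ≤ 6`.
* **`mtRank_hodge_one_eq_six_of_isIsogenous_powSucc_prod_powSucc_surface`** /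
  **`mtRank_hodge_one_eq_six_of_isIsogenous_powSucc_prod_biproduct_elliptic`** — `X ∼ B^{m+1} × S^{N+1}` (`S` a simple CM
  surface), resp. `X ∼ B^{m+1} × ⨁_j E_{cls j}` (`E₀ ≁ E₁` CM elliptic curves, both occurring) ⟹ `dim MT(H¹X) = 6`
  EXACTLY: `≤ 6` by the bound; `≠ 4, 5` because the rungs `4` and `5` have the shapes `B'^{m'+1}`, `B'^{m'+1} × E^{N'+1}`
  (`CorCM/MumfordTateRankFour`, `…RankSixClassification`) and the simple CM factor `S` (resp. `E₀`, `E₁`) of `X` would be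
  isogenous to `B'` or to `E` (uniqueness of simple isogeny factors,
  `exists_isIsogenous_of_isSimple_of_avDominatedBy_biproduct`) — impossible (CM vs non-CM, dimension, `E₀ ≁ E₁`).
* **`not_isOfCMType_and_mtRank_hodge_one_eq_six_iff`** — the rung `dim MT(H¹X) = 6`, `X` not of CM type, as an IFF:
  `X ∼ B^{m+1} × S^{N+1}` or `X ∼ B^{m+1} × E₀^{a} × E₁^{b}` (Moonen–Zarhin: Hodge group `SL₂ · T²`).

## References

* [MoonenZarhin1999LowDim] B. Moonen, Yu. Zarhin, *Hodge classes on abelian varieties of low dimension*, Math. Ann.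
  315 (1999), §2 (2.1)–(2.5) and §3.
* [MumfordAV1970] D. Mumford, *Abelian Varieties* (1970), §19 Thm. 1, Cor. 1–2 (pp. 173–174).
* [Deligne1982HodgeCycles] P. Deligne, *Hodge cycles on abelian varieties*, LNM 900 (1982), I §3.1, Prop. 3.4, Ex. 3.7.
* [Gordon1999HodgeAVSurvey] B. B. Gordon, *A survey of the Hodge conjecture for abelian varieties* (1999), 7.4–7.7.
-/

noncomputable section

open CategoryTheory CategoryTheory.Limits Module

namespace Summit.HodgeConjecture.CorCM

open Literature.AlgebraicGeometry.Motives
open Literature.AlgebraicGeometry.Motives.AbelianVariety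
open Literature.AlgebraicGeometry.Motives.HodgeStructure
open Literature.AlgebraicGeometry.HodgeTheory
open Literature.AlgebraicGeometry.ComplexMultiplication (isIsogenous_biproduct_powSucc)
open Literature.AlgebraicGeometry.Milne1999 (IsOfCMType isOfCMType_iff_of_isIsogenous isOfCMType_prod_iff
  isOfCMType_powSucc_iff)
open Summit.HodgeConjecture.CorCM.Domination

variable [HodgeTensorFacts.{0, 0}] {X : AbelianVariety ℂ} {n : ℕ}

omit [HodgeTensorFacts.{0, 0}] in
/-- `4 ≤ t ≤ 6`, `t ≠ 4` ⟹ `t = 5 ∨ t = 6` (isolated so that `omega` sees only these atoms). [folklore] -/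
private theorem eq_five_or_eq_six {t : ℕ} (h4 : 4 ≤ t) (h6 : t ≤ 6) (hne : t ≠ 4) : t = 5 ∨ t = 6 := by omega

omit [HodgeTensorFacts.{0, 0}] in
/-- **`Y × Z ∼ ⨁ (Y, Z)`**: the binary product is isomorphic to the biproduct of the pair family (both are biproducts of
`Y` and `Z`). [cite: MumfordAV1970, §19 (Hom(C, A × B) = Hom(C, A) ⊕ Hom(C, B))] -/
private theorem isIsogenous_prod_biproduct_pairFunction (Y Z : AbelianVariety ℂ) :
    IsIsogenous (Y.prod Z) (⨁ pairFunction Y Z) := by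
  -- both `Y ⊞ Z` and `⨁ pairFunction Y Z` are bilimit bicones of the pair
  let e : (⨁ pairFunction Y Z) ≅ Y ⊞ Z :=
    biprod.uniqueUpToIso Y Z (b := (biproduct.bicone (pairFunction Y Z)).toBinaryBicone)
      ((Bicone.toBinaryBiconeIsBilimit _).symm (biproduct.isBilimit _))
  exact ⟨(biprodIsoProd Y Z).inv ≫ e.inv, isIsogeny_hom_of_iso ((biprodIsoProd Y Z).symm ≪≫ e.symm)⟩

/-! ## §1 `dim Lie Hg(H¹(B^{m+1} × Z)) ≤ dim Lie Hg(H¹B) + dim Lie Hg(H¹Z)` -/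

/-- **`X ∼ B^{m+1} × Z` ⟹ `dim Lie Hg(H¹X) ≤ dim Lie Hg(H¹B) + dim Lie Hg(H¹Z)`** (any complex abelian varieties `B`,
`Z`): isogeny invariance, `Hg(Y × Z) ⊆ Hg(Y) × Hg(Z)` and `Hg(B^{m+1}) = Hg(B)` in Lie form
(`finrank_hodgeLie_hodge_one_biproduct_le_sum`, `…_biproduct_const_le`). [cite: MoonenZarhin1999LowDim, §3]
[cite: Deligne1982HodgeCycles, I §3.1 and Prop. 3.4] -/
theorem finrank_hodgeLie_hodge_one_le_add_of_isIsogenous_powSucc_prod (hX : IsSmoothProjective n X.X)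
    {B Z : AbelianVariety ℂ} {m : ℕ} (hXBZ : IsIsogenous X ((B.powSucc m).prod Z)) :
    haveI := BettiUniverse.finite hX 1
    haveI := BettiUniverse.finite (AbelianVariety.isSmoothProjective_holds (A := B)) 1
    haveI := BettiUniverse.finite (AbelianVariety.isSmoothProjective_holds (A := Z)) 1
    Module.finrank ℚ (BettiUniverse.hodge exists_isReal_hodgeModel_holds hX 1).hodgeLie ≤
      Module.finrank ℚ (BettiUniverse.hodge exists_isReal_hodgeModel_holds
          (AbelianVariety.isSmoothProjective_holds (A := B)) 1).hodgeLie +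
        Module.finrank ℚ (BettiUniverse.hodge exists_isReal_hodgeModel_holds
          (AbelianVariety.isSmoothProjective_holds (A := Z)) 1).hodgeLie := by
  classical
  have hsp : ∀ A : AbelianVariety ℂ, IsSmoothProjective A.dim A.X := fun A => AbelianVariety.isSmoothProjective_holds
  haveI := BettiUniverse.finite hX 1
  haveI : ∀ A : AbelianVariety ℂ, Module.Finite ℚ (bettiCohomology A.X 1) := fun A => BettiUniverse.finite (hsp A) 1
  -- `X ∼ B^{m+1} × Z ∼ ⨁ (pairFunction B^{m+1} Z)`
  have hXb : IsIsogenous X (⨁ pairFunction (B.powSucc m) Z) :=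
    hXBZ.trans (isIsogenous_prod_biproduct_pairFunction (B.powSucc m) Z)
  have h1 := finrank_hodgeLie_hodge_one_eq_of_isIsogenous hX (hsp (⨁ pairFunction (B.powSucc m) Z)) hXb
  have h2 := finrank_hodgeLie_hodge_one_biproduct_le_sum (A := pairFunction (B.powSucc m) Z)
    (d := fun j => (pairFunction (B.powSucc m) Z j).dim) (fun j => hsp _) (hsp (⨁ pairFunction (B.powSucc m) Z))
  have hsum : ∑ j : WalkingPair, Module.finrank ℚ (BettiUniverse.hodge exists_isReal_hodgeModel_holds
      (hsp (pairFunction (B.powSucc m) Z j)) 1).hodgeLie =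
      Module.finrank ℚ (BettiUniverse.hodge exists_isReal_hodgeModel_holds (hsp (B.powSucc m)) 1).hodgeLie +
        Module.finrank ℚ (BettiUniverse.hodge exists_isReal_hodgeModel_holds (hsp Z) 1).hodgeLie := by
    rw [Fintype.sum_equiv WalkingPair.equivBool _
      (fun b => Module.finrank ℚ (BettiUniverse.hodge exists_isReal_hodgeModel_holds
        (hsp (pairFunction (B.powSucc m) Z (WalkingPair.equivBool.symm b))) 1).hodgeLie)
      (fun j => by rw [Equiv.symm_apply_apply]), Fintype.sum_bool]
    rfl
  -- `dim Lie Hg(H¹(B^{m+1})) ≤ dim Lie Hg(H¹B)`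
  have h3 := finrank_hodgeLie_hodge_one_eq_of_isIsogenous (hsp (⨁ fun _ : Fin (m + 1) => B)) (hsp (B.powSucc m))
    (isIsogenous_biproduct_powSucc B m)
  have h4 := finrank_hodgeLie_hodge_one_biproduct_const_le (hsp B) (hsp (⨁ fun _ : Fin (m + 1) => B))
  have h2' : Module.finrank ℚ (BettiUniverse.hodge exists_isReal_hodgeModel_holds
      (hsp (⨁ pairFunction (B.powSucc m) Z)) 1).hodgeLie ≤
      Module.finrank ℚ (BettiUniverse.hodge exists_isReal_hodgeModel_holds (hsp (B.powSucc m)) 1).hodgeLie +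
        Module.finrank ℚ (BettiUniverse.hodge exists_isReal_hodgeModel_holds (hsp Z) 1).hodgeLie := by
    rw [← hsum]
    exact h2
  omega

/-! ## §2 `X ∼ B^{m+1} × Z` with `dim Lie Hg(H¹Z) ≤ 2`: not of CM type, `dim MT(H¹X) ≤ 6` -/

section Shapes

variable {B Z : AbelianVariety ℂ} {m : ℕ}

/-- **`X ∼ B^{m+1} × Z` with `B` a non-CM elliptic curve or a QM surface and `dim Lie Hg(H¹Z) ≤ 2` ⟹ `X` is NOT of CM
type and `dim MT(H¹(X)) ≤ 6`** (`dim Lie Hg(H¹X) ≤ 3 + 2`, `dim MT = dim Lie Hg + 1`; the factor `B` is not of CM type).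
[cite: MoonenZarhin1999LowDim, §2 (2.1)–(2.5) and §3] [cite: Deligne1982HodgeCycles, I Prop. 3.4] -/
theorem not_isOfCMType_and_mtRank_le_six_of_isIsogenous_powSucc_prod (hX : IsSmoothProjective n X.X) (h0 : 0 < X.dim)
    (hBs : B.IsSimple) (hB0 : 0 < B.dim) (hB2 : B.dim ≤ 2) (hBcm : ¬ IsOfCMType B)
    (hfinB : Module.finrank ℚ B.endAlgebra = B.dim ^ 2)
    (hZ2 : haveI := BettiUniverse.finite (AbelianVariety.isSmoothProjective_holds (A := Z)) 1
      Module.finrank ℚ (BettiUniverse.hodge exists_isReal_hodgeModel_holds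
        (AbelianVariety.isSmoothProjective_holds (A := Z)) 1).hodgeLie ≤ 2)
    (hXBZ : IsIsogenous X ((B.powSucc m).prod Z)) :
    haveI := BettiUniverse.finite hX 1
    ¬ IsOfCMType X ∧ (BettiUniverse.hodge exists_isReal_hodgeModel_holds hX 1).mtRank ≤ 6 := by
  haveI := BettiUniverse.finite hX 1
  have hcm : ¬ IsOfCMType X := fun h => hBcm
    ((isOfCMType_powSucc_iff m).1 (isOfCMType_prod_iff.1 ((isOfCMType_iff_of_isIsogenous hXBZ).1 h)).1)
  obtain ⟨-, h3B⟩ := not_le_endAlg_and_finrank_hodgeLie_le_three_of_factor hBs hB0 hBcm hfinB hB2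
  have hle := finrank_hodgeLie_hodge_one_le_add_of_isIsogenous_powSucc_prod hX hXBZ
  refine ⟨hcm, ?_⟩
  rw [mtRank_hodge_one_eq_finrank_hodgeLie_add_one hX h0]
  omega

/-- **`X ∼ B^{m+1} × Z` with `Z` of positive dimension and `dim MT(H¹Z) ≤ 3` ⟹ `X` not of CM type, `dim MT(H¹X) ≤ 6`.**
[cite: MoonenZarhin1999LowDim, §2 (2.1)–(2.5) and §3] [cite: Deligne1982HodgeCycles, I Prop. 3.4] -/
theorem not_isOfCMType_and_mtRank_le_six_of_isIsogenous_powSucc_prod_of_mtRank_le_three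
    (hX : IsSmoothProjective n X.X) (h0 : 0 < X.dim)
    (hBs : B.IsSimple) (hB0 : 0 < B.dim) (hB2 : B.dim ≤ 2) (hBcm : ¬ IsOfCMType B)
    (hfinB : Module.finrank ℚ B.endAlgebra = B.dim ^ 2) (hZ0 : 0 < Z.dim)
    (hZ3 : haveI := BettiUniverse.finite (AbelianVariety.isSmoothProjective_holds (A := Z)) 1
      (BettiUniverse.hodge exists_isReal_hodgeModel_holds (AbelianVariety.isSmoothProjective_holds (A := Z)) 1).mtRank ≤ 3)
    (hXBZ : IsIsogenous X ((B.powSucc m).prod Z)) :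
    haveI := BettiUniverse.finite hX 1
    ¬ IsOfCMType X ∧ (BettiUniverse.hodge exists_isReal_hodgeModel_holds hX 1).mtRank ≤ 6 := by
  have hZ := mtRank_hodge_one_eq_finrank_hodgeLie_add_one (AbelianVariety.isSmoothProjective_holds (A := Z)) hZ0
  exact not_isOfCMType_and_mtRank_le_six_of_isIsogenous_powSucc_prod hX h0 hBs hB0 hB2 hBcm hfinB (by omega) hXBZ

/-! ## §3 A simple CM isogeny factor excludes the rungs `4` and `5` -/

/-- **A simple isogeny factor of positive dimension of `X`, of CM type and not an elliptic curve isogenous to every CM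
elliptic factor, forces `dim MT(H¹X) ∉ {4, 5}`.**  Technical core: if `X` is NOT of CM type with `dim MT(H¹X) ≤ 5` and
`S ≼ X` is SIMPLE of CM type with `0 < dim S`, then `dim S = 1` and, for `dim MT(H¹X) = 5`... — we only need the two
consequences below, proved directly: (a) `dim MT(H¹X) = 4` is impossible (`X ∼ B'^{m'+1}`, `B'` simple non-CM, and
`S ∼ B'`); (b) if `dim MT(H¹X) = 5` then `S` is an elliptic curve isogenous to the CM elliptic factor `E` of
`X ∼ B'^{m'+1} × E^{N'+1}`. [cite: MumfordAV1970, §19 Thm. 1, Cor. 1–2 (pp. 173–174)] [cite: MoonenZarhin1999LowDim, §2] -/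
theorem mtRank_ne_four_and_of_cm_simple_factor (hX : IsSmoothProjective n X.X) (h0 : 0 < X.dim) (hcm : ¬ IsOfCMType X)
    {S : AbelianVariety ℂ} (hSs : S.IsSimple) (hS0 : 0 < S.dim) (hScm : IsOfCMType S) (hSX : AVDominatedBy S X) :
    haveI := BettiUniverse.finite hX 1
    (BettiUniverse.hodge exists_isReal_hodgeModel_holds hX 1).mtRank ≠ 4 ∧
      ((BettiUniverse.hodge exists_isReal_hodgeModel_holds hX 1).mtRank = 5 →
        ∃ E : AbelianVariety ℂ, E.dim = 1 ∧ IsOfCMType E ∧ IsIsogenous S E ∧ S.dim = 1) := by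
  classical
  haveI := BettiUniverse.finite hX 1
  constructor
  · intro h4
    obtain ⟨B', m', hB's, -, hB'cm, hXB', -⟩ := exists_isIsogenous_power_of_not_isOfCMType hX h0 hcm (le_of_eq h4)
    obtain ⟨f, hf⟩ := hXB'
    obtain ⟨j, hj⟩ := exists_isIsogenous_of_isSimple_of_avDominatedBy_biproduct (fun _ => hB's) hSs hS0
      (hSX.trans_isIsogeny_hom hf)
    exact hB'cm ((isOfCMType_iff_of_isIsogenous hj).1 hScm)
  · intro h5
    obtain ⟨B', m', E, N', hB's, -, -, hB'cm, -, -, hE1, hEcm, hXB'E⟩ :=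
      shape_of_not_isOfCMType_of_mtRank_hodge_one_eq_five' hX h0 hcm h5
    -- `X ≼ ⨁ (B' … B', E … E)`, a biproduct of simple abelian varieties
    have hdom : AVDominatedBy ((B'.powSucc m').prod (E.powSucc N'))
        (⨁ AndreRiemann.sumFam (fun _ : Fin (m' + 1) => B') (fun _ : Fin (N' + 1) => E)) :=
      AndreRiemann.avDominatedBy_prod_of_biproduct
        (AVDominatedBy.of_isIsogenous (isIsogenous_biproduct_powSucc B' m').symm' (AVDominatedBy.refl _))
        (AVDominatedBy.of_isIsogenous (isIsogenous_biproduct_powSucc E N').symm' (AVDominatedBy.refl _))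
    have hE's : E.IsSimple := AbelianVariety.isSimple_of_dim_le_one hE1.le
    have hsimple : ∀ j, (AndreRiemann.sumFam (fun _ : Fin (m' + 1) => B') (fun _ : Fin (N' + 1) => E) j).IsSimple := by
      rintro (j | j)
      · exact hB's
      · exact hE's
    obtain ⟨f, hf⟩ := hXB'E
    obtain ⟨j, hj⟩ := exists_isIsogenous_of_isSimple_of_avDominatedBy_biproduct hsimple hSs hS0
      ((hSX.trans_isIsogeny_hom hf).trans hdom)
    rcases j with j | j
    · exact absurd ((isOfCMType_iff_of_isIsogenous hj).1 hScm) hB'cm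
    · have hjE : IsIsogenous S E := hj
      obtain ⟨g, hg⟩ := hjE
      exact ⟨E, hE1, hEcm, ⟨g, hg⟩, by rw [dim_eq_of_isIsogeny hg, hE1]⟩

/-! ## §4 The two shapes of the rung `6` have Mumford–Tate rank exactly `6` -/

/-- **`X ∼ B^{m+1} × S^{N+1}` (`B` a non-CM elliptic curve or QM surface, `S` a SIMPLE abelian SURFACE of CM type) ⟹ `X` is
not of CM type and `dim MT(H¹(X)) = 6`** (Hodge group `SL₂ × Hg(S)`, `Hg(S)` a `2`-torus).  `≤ 6`: §2 with
`dim MT(H¹(S^{N+1})) = 3`; `≠ 4, 5`: §3 with the simple CM surface `S ≼ X`.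
[cite: MoonenZarhin1999LowDim, §2 (2.1)–(2.5)] [cite: MumfordAV1970, §19 Thm. 1, Cor. 1–2 (pp. 173–174)]
[cite: Gordon1999HodgeAVSurvey, 7.4–7.7] -/
theorem mtRank_hodge_one_eq_six_of_isIsogenous_powSucc_prod_powSucc_surface (hX : IsSmoothProjective n X.X)
    (h0 : 0 < X.dim) (hBs : B.IsSimple) (hB0 : 0 < B.dim) (hB2 : B.dim ≤ 2) (hBcm : ¬ IsOfCMType B)
    (hfinB : Module.finrank ℚ B.endAlgebra = B.dim ^ 2) {S : AbelianVariety ℂ} {N : ℕ} (hSs : S.IsSimple)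
    (hS2 : S.dim = 2) (hScm : IsOfCMType S) (hXBS : IsIsogenous X ((B.powSucc m).prod (S.powSucc N))) :
    haveI := BettiUniverse.finite hX 1
    ¬ IsOfCMType X ∧ (BettiUniverse.hodge exists_isReal_hodgeModel_holds hX 1).mtRank = 6 := by
  haveI := BettiUniverse.finite hX 1
  have hZ0 : 0 < (S.powSucc N).dim := Literature.AlgebraicGeometry.Milne1999.dim_powSucc_pos (by omega) N
  have hZ3 : haveI := BettiUniverse.finite (AbelianVariety.isSmoothProjective_holds (A := S.powSucc N)) 1
      (BettiUniverse.hodge exists_isReal_hodgeModel_holds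
        (AbelianVariety.isSmoothProjective_holds (A := S.powSucc N)) 1).mtRank = 3 :=
    (mtRank_hodge_one_eq_three_iff_surface_or_elliptic AbelianVariety.isSmoothProjective_holds hZ0).2
      (Or.inl ⟨S, hSs, hS2, hScm, N, IsIsogenous.refl _⟩)
  obtain ⟨hcm, h6⟩ := not_isOfCMType_and_mtRank_le_six_of_isIsogenous_powSucc_prod_of_mtRank_le_three hX h0 hBs hB0
    hB2 hBcm hfinB hZ0 (le_of_eq hZ3) hXBS
  have h4 := four_le_mtRank_hodge_one_of_not_isOfCMType hX hcm
  -- the simple CM surface `S ≼ X`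
  obtain ⟨f, hf⟩ := hXBS
  have hSX : AVDominatedBy S X :=
    (((avDominatedBy_powSucc_of_le S (Nat.zero_le N)).trans (avDominatedBy_prod_right _ _)).trans_isIsogeny_inv hf)
  obtain ⟨hne4, h5⟩ := mtRank_ne_four_and_of_cm_simple_factor hX h0 hcm hSs (by omega) hScm hSX
  refine ⟨hcm, ?_⟩
  rcases eq_five_or_eq_six h4 h6 hne4 with h | h
  · obtain ⟨-, -, -, -, hS1⟩ := h5 h
    omega
  · exact h

/-- **`X ∼ B^{m+1} × ⨁_j E_{cls j}` (`B` a non-CM elliptic curve or QM surface; `E₀ ≁ E₁` CM elliptic curves, both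
occurring) ⟹ `X` is not of CM type and `dim MT(H¹(X)) = 6`** (Hodge group `SL₂ × U(1)²`).  `≤ 6`: §2 with
`dim MT(H¹(E₀^{a} × E₁^{b})) = 3`; `≠ 4, 5`: §3 — at rank `5` both `E₀` and `E₁` would be isogenous to the single CM
elliptic factor, contradicting `E₀ ≁ E₁`. [cite: MoonenZarhin1999LowDim, §2 (2.1)–(2.5)]
[cite: MumfordAV1970, §19 Thm. 1, Cor. 1–2 (pp. 173–174)] [cite: Gordon1999HodgeAVSurvey, 7.4–7.7] -/
theorem mtRank_hodge_one_eq_six_of_isIsogenous_powSucc_prod_biproduct_elliptic (hX : IsSmoothProjective n X.X)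
    (h0 : 0 < X.dim) (hBs : B.IsSimple) (hB0 : 0 < B.dim) (hB2 : B.dim ≤ 2) (hBcm : ¬ IsOfCMType B)
    (hfinB : Module.finrank ℚ B.endAlgebra = B.dim ^ 2) {E : Fin 2 → AbelianVariety ℂ} {k : ℕ}
    {cls : Fin (k + 1) → Fin 2} (hE1 : ∀ i, (E i).dim = 1) (hEcm : ∀ i, IsOfCMType (E i))
    (hEni : ¬ IsIsogenous (E 0) (E 1)) (hcls : Function.Surjective cls)
    (hXBE : IsIsogenous X ((B.powSucc m).prod (⨁ fun j => E (cls j)))) :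
    haveI := BettiUniverse.finite hX 1
    ¬ IsOfCMType X ∧ (BettiUniverse.hodge exists_isReal_hodgeModel_holds hX 1).mtRank = 6 := by
  classical
  haveI := BettiUniverse.finite hX 1
  set Z : AbelianVariety ℂ := ⨁ fun j => E (cls j) with hZdef
  have hZ0 : 0 < Z.dim := by
    rw [hZdef, AndreRiemann.dim_biproduct_fin]
    exact Finset.sum_pos' (fun _ _ => Nat.zero_le _) ⟨0, Finset.mem_univ _, by rw [hE1]; exact Nat.one_pos⟩
  have hZ3 : haveI := BettiUniverse.finite (AbelianVariety.isSmoothProjective_holds (A := Z)) 1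
      (BettiUniverse.hodge exists_isReal_hodgeModel_holds (AbelianVariety.isSmoothProjective_holds (A := Z)) 1).mtRank = 3 :=
    (mtRank_hodge_one_eq_three_iff_surface_or_elliptic AbelianVariety.isSmoothProjective_holds hZ0).2
      (Or.inr ⟨E, hE1, hEcm, hEni, k, cls, hcls, IsIsogenous.refl _⟩)
  obtain ⟨hcm, h6⟩ := not_isOfCMType_and_mtRank_le_six_of_isIsogenous_powSucc_prod_of_mtRank_le_three hX h0 hBs hB0
    hB2 hBcm hfinB hZ0 (le_of_eq hZ3) hXBE
  have h4 := four_le_mtRank_hodge_one_of_not_isOfCMType hX hcm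
  -- the CM elliptic curves `E i ≼ X`
  obtain ⟨f, hf⟩ := hXBE
  have hEX : ∀ i, AVDominatedBy (E i) X := by
    intro i
    obtain ⟨j, hj⟩ := hcls i
    have h1 : AVDominatedBy (E i) Z := by
      rw [← hj]
      exact avDominatedBy_biproduct_summand (fun j => E (cls j)) j
    exact (h1.trans (avDominatedBy_prod_right _ _)).trans_isIsogeny_inv hf
  have hEs : ∀ i, (E i).IsSimple := fun i => AbelianVariety.isSimple_of_dim_le_one (hE1 i).le
  obtain ⟨hne4, h5⟩ := mtRank_ne_four_and_of_cm_simple_factor hX h0 hcm (hEs 0) (by rw [hE1]; exact Nat.one_pos)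
    (hEcm 0) (hEX 0)
  obtain ⟨-, h5'⟩ := mtRank_ne_four_and_of_cm_simple_factor hX h0 hcm (hEs 1) (by rw [hE1]; exact Nat.one_pos)
    (hEcm 1) (hEX 1)
  refine ⟨hcm, ?_⟩
  rcases eq_five_or_eq_six h4 h6 hne4 with h | h
  · -- both `E 0` and `E 1` are isogenous to THE CM elliptic factor of the rung `5`: but that factor is unique
    exfalso
    obtain ⟨E₀, -, -, hE₀, -⟩ := h5 h
    obtain ⟨E₁, -, -, hE₁, -⟩ := h5' h
    -- the rung-5 shape is produced ONCE for `X`; re-run §3(b) through a single application to compare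
    obtain ⟨B', m', E', N', hB's, -, -, hB'cm, -, -, hE'1, -, hXB'E'⟩ :=
      shape_of_not_isOfCMType_of_mtRank_hodge_one_eq_five' hX h0 hcm h
    have hdom : AVDominatedBy ((B'.powSucc m').prod (E'.powSucc N'))
        (⨁ AndreRiemann.sumFam (fun _ : Fin (m' + 1) => B') (fun _ : Fin (N' + 1) => E')) :=
      AndreRiemann.avDominatedBy_prod_of_biproduct
        (AVDominatedBy.of_isIsogenous (isIsogenous_biproduct_powSucc B' m').symm' (AVDominatedBy.refl _))
        (AVDominatedBy.of_isIsogenous (isIsogenous_biproduct_powSucc E' N').symm' (AVDominatedBy.refl _))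
    have hsimple : ∀ j, (AndreRiemann.sumFam (fun _ : Fin (m' + 1) => B') (fun _ : Fin (N' + 1) => E') j).IsSimple := by
      rintro (j | j)
      · exact hB's
      · exact AbelianVariety.isSimple_of_dim_le_one hE'1.le
    obtain ⟨g, hg⟩ := hXB'E'
    have hiso : ∀ i, IsIsogenous (E i) E' := by
      intro i
      obtain ⟨j, hj⟩ := exists_isIsogenous_of_isSimple_of_avDominatedBy_biproduct hsimple (hEs i)
        (by rw [hE1]; exact Nat.one_pos) (((hEX i).trans_isIsogeny_hom hg).trans hdom)
      rcases j with j | j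
      · exact absurd ((isOfCMType_iff_of_isIsogenous hj).1 (hEcm i)) hB'cm
      · exact hj
    exact hEni ((hiso 0).trans (hiso 1).symm')
  · exact h

end Shapes

/-! ## §5 The rung `dim MT(H¹X) = 6`, `X` not of CM type, as an iff -/

/-- **The rung `6` of the Mumford–Tate ladder in closed form.**  For a complex abelian variety `X` with `0 < dim X`:
`X` is NOT of CM type with `dim MT(H¹(X)) = 6` IFF `X ∼ B^{m+1} × S^{N+1}` or `X ∼ B^{m+1} × ⨁_j E_{cls j}`, where `B` is
SIMPLE, not of CM type, `0 < dim B ≤ 2`, `dim_ℚ End⁰(B) = (dim B)²`, `Z(End⁰ B) = ℚ` (a non-CM elliptic curve or a QM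
surface), `S` is a simple CM abelian surface, and `E₀ ≁ E₁` are CM elliptic curves both occurring
(`cls : Fin (k+1) → Fin 2` surjective) — Moonen–Zarhin's Hodge groups `SL₂ · T²`.
[cite: MoonenZarhin1999LowDim, §2 (2.1)–(2.5)] [cite: MumfordAV1970, §19 Thm. 1, Cor. 1–2 (pp. 173–174)]
[cite: Gordon1999HodgeAVSurvey, 7.4–7.7] -/
theorem not_isOfCMType_and_mtRank_hodge_one_eq_six_iff (hX : IsSmoothProjective n X.X) (h0 : 0 < X.dim) :
    haveI := BettiUniverse.finite hX 1
    (¬ IsOfCMType X ∧ (BettiUniverse.hodge exists_isReal_hodgeModel_holds hX 1).mtRank = 6) ↔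
      ∃ (B : AbelianVariety ℂ) (m : ℕ), B.IsSimple ∧ 0 < B.dim ∧ B.dim ≤ 2 ∧ ¬ IsOfCMType B ∧
        Module.finrank ℚ B.endAlgebra = B.dim ^ 2 ∧ Module.finrank ℚ (Subalgebra.center ℚ B.endAlgebra) = 1 ∧
        ((∃ (S : AbelianVariety ℂ) (N : ℕ), S.IsSimple ∧ S.dim = 2 ∧ IsOfCMType S ∧
            IsIsogenous X ((B.powSucc m).prod (S.powSucc N))) ∨
          (∃ (E : Fin 2 → AbelianVariety ℂ) (k : ℕ) (cls : Fin (k + 1) → Fin 2),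
            (∀ i, (E i).dim = 1) ∧ (∀ i, IsOfCMType (E i)) ∧ ¬ IsIsogenous (E 0) (E 1) ∧ Function.Surjective cls ∧
            IsIsogenous X ((B.powSucc m).prod (⨁ fun j => E (cls j))))) := by
  haveI := BettiUniverse.finite hX 1
  constructor
  · rintro ⟨hcm, h6⟩
    exact shape_of_not_isOfCMType_of_mtRank_hodge_one_eq_six hX h0 hcm h6
  · rintro ⟨B, m, hBs, hB0, hB2, hBcm, hfinB, -, hshape⟩
    rcases hshape with ⟨S, N, hSs, hS2, hScm, hXBS⟩ | ⟨E, k, cls, hE1, hEcm, hEni, hcls, hXBE⟩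
    · exact mtRank_hodge_one_eq_six_of_isIsogenous_powSucc_prod_powSucc_surface hX h0 hBs hB0 hB2 hBcm hfinB hSs hS2
        hScm hXBS
    · exact mtRank_hodge_one_eq_six_of_isIsogenous_powSucc_prod_biproduct_elliptic hX h0 hBs hB0 hB2 hBcm hfinB hE1 hEcm
        hEni hcls hXBE

end Summit.HodgeConjecture.CorCM

end
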